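import Mathlib
import Summits.NavierStokesRegularity.NavierStokesRegularity.Theorems.TaylorModelRungThreeCertificateIntervalDJetsArray
import Literature.Analysis.ODE.HighOrderEnclosureIntervalTest
import HarnessLib

/-!
# The one-shift window system, XXVIIIa: DYADIC BOXES AS REAL BOXES — the small bridge between the executable
# interval layer `TaylorModelCert.IntervalD` and the real boxes `boxSet` of the Literature enclosure theorems, used
# by the centre-step test (part XXVIII) (cell harvest/h2-tao-ladder, seat p2; rung1/KERNEL-CHEAP-REPLAY-SPEC.md §7
# «CHECKER»; support for K1(1) = `NoSurvivingDSSOne`, stmt-NavierStokesRegularity-20205)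

MODEL-lattice bookkeeping only; nothing here is a statement about the Navier–Stokes equations; nothing is
certified. Contents: the Boolean well-formedness tests `wfD` (`lo ≤ hi`) / `wfsD` (`lo < hi`); `toNI` (a dyadic
interval as a `NonemptyInterval ℝ`, with `mem_toNI`, `mem_of_mem_toNI`, `toNI_fst_lt_snd`); `boxOf e A` (an array
of dyadic intervals read through a numbering `e : ι ≃ Fin n` as a real box); `mem_sum_equiv` (a rounded range sum
encloses a sum over `ι`).
-/

-- the sub-problem namespace repeats the summit name by design (D-0017)
set_option linter.dupNamespace false

namespace Summit.NavierStokesRegularity.NavierStokesRegularity.Theorems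

namespace DSSOneShift

open Set Finset
open Literature.Analysis.ODE
open Summit.NavierStokesRegularity.NavierStokesRegularity.Theorems.TaylorModelCert

/-! ### Well-formed dyadic intervals as real intervals -/

/-- TEST `lo ≤ hi`. [folklore] -/
def wfD (I : IntervalD) : Bool := Dyad.ble I.lo I.hi

/-- TEST `lo < hi`. [folklore] -/
def wfsD (I : IntervalD) : Bool := Dyad.blt I.lo I.hi

/-- A dyadic interval as a real non-empty interval (`[lo, lo]` if malformed). [cite: Moore1979, §2.1 and §3.2] -/
noncomputable def toNI (I : IntervalD) : NonemptyInterval ℝ :=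
  if h : I.lo.toReal ≤ I.hi.toReal then ⟨(I.lo.toReal, I.hi.toReal), h⟩ else ⟨(I.lo.toReal, I.lo.toReal), le_rfl⟩

/-- Members are members of the real interval. [folklore] -/
theorem mem_toNI {x : ℝ} {I : IntervalD} (hx : IntervalD.mem x I) : x ∈ toNI I := by
  have h : I.lo.toReal ≤ I.hi.toReal := hx.1.trans hx.2
  rw [toNI, dif_pos h, NonemptyInterval.mem_def]
  exact hx

/-- For a well-formed interval the converse holds. [folklore] -/
theorem mem_of_mem_toNI {x : ℝ} {I : IntervalD} (hwf : wfD I = true) (hx : x ∈ toNI I) : IntervalD.mem x I := by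
  have h : I.lo.toReal ≤ I.hi.toReal := (Dyad.ble_iff _ _).1 hwf
  rw [toNI, dif_pos h, NonemptyInterval.mem_def] at hx
  exact hx

/-- A strictly well-formed interval is non-degenerate. [folklore] -/
theorem toNI_fst_lt_snd {I : IntervalD} (hwf : wfsD I = true) : (toNI I).fst < (toNI I).snd := by
  have h : I.lo.toReal < I.hi.toReal := (Dyad.blt_iff _ _).1 hwf
  rw [toNI, dif_pos h.le]
  exact h

/-- Strictly well-formed is well-formed. [folklore] -/
theorem wfD_of_wfsD {I : IntervalD} (hwf : wfsD I = true) : wfD I = true :=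
  (Dyad.ble_iff _ _).2 ((Dyad.blt_iff _ _).1 hwf).le

/-- The real box of an array of dyadic intervals read through a numbering `e`. [cite: Moore1979, §2.1 (interval vectors)] -/
noncomputable def boxOf {ι : Type*} {n : ℕ} (e : ι ≃ Fin n) (A : Array IntervalD) : ι → NonemptyInterval ℝ :=
  fun i => toNI (IntervalD.aget A (e i))

/-! ### Sums over `ι` as range sums -/

/-- A rounded range sum encloses a sum over `ι` numbered by `e`. [cite: Moore1979, §3.2 (inclusion property)] -/
theorem mem_sum_equiv {ι : Type*} [Fintype ι] {n : ℕ} (e : ι ≃ Fin n) (prec : ℕ) {g : ι → ℝ} {F : ℕ → IntervalD}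
    (h : ∀ k (hk : k < n), IntervalD.mem (g (e.symm ⟨k, hk⟩)) (F k)) :
    IntervalD.mem (∑ k, g k) (IntervalD.rangeSumR prec F n) := by
  have hsum : ∑ k, g k = ∑ k ∈ Finset.range n, (fun m => if hm : m < n then g (e.symm ⟨m, hm⟩) else 0) k := by
    rw [← Equiv.sum_comp e.symm, ← Fin.sum_univ_eq_sum_range]
    refine Finset.sum_congr rfl fun i _ => ?_
    simp only [dif_pos i.isLt, Fin.eta]
  rw [hsum]
  exact IntervalD.mem_rangeSumR prec n fun m hm => by simp only [dif_pos hm]; exact h m hm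

end DSSOneShift

end Summit.NavierStokesRegularity.NavierStokesRegularity.Theorems
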